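import Summits.CriticalPhenomena.PercolationContinuityZ3.Theorems.PercNearOneGluingNoHeavyLowerTailCILDeficiency
import HarnessLib

/-!
# `NoHeavyLowerTail` (stmt-CriticalPhenomena-4575) — the ATTACHED-CHAMPION inequality (XZ, T-form) up to an explicit deficiency,
# and XZ-H / port domination for relay-neighboured observers

Support file (prover `prim-hp-5`, hull-port cell, blob-quotient technique; `--supports stmt-CriticalPhenomena-4575`).
No definitions, no named facts, no sorries.

Notation as in `…CILDeficiency`: `μ = prodBernoulli w`, relays `A`, observer `o ∉ A`, level `j`, `L = {1 ≤ N ≤ j}`,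
`R_q = {|π(q)| ≤ j}`, `s(y) = μ{|π'(y)| ≤ j}` the lightness in `G − o`, `σ_B` the star of `o`, `Γ` its positive-weight
neighbours, `E_Γ = {some pair o–y, y ∈ Γ, is open}`.

The T-form ("attached champion", registered stubs `stub_attachedChampion` / `stub_attachedChampionDeleted` of the lead's
hull-port programme) asks for `μ(L) ≤ μ(R_q ∩ {1 ≤ N})` — CIL without the slack `μ(R_q ∩ {N = 0})`.  Summing the quantitative
star transfer (`CutObserver.star_transfer_add` with the QLM slack of `CutObserver.observerSet_le_add_posPart`) over the NONEMPTY
stars only gives it up to the same deficiency as `cil_add_starDeficiency`: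

* `xz_add_starDeficiency` — for every observer `o ∉ A`, every vertex `q ≠ o` and every member selector `f`:
  `μ(L) ≤ μ(R_q ∩ E_Γ) + Σ_{∅ ≠ B ⊆ Γ} μ(σ_B)·max (s(f B) − s(q)) 0`.
* `attachedChampion_of_relayPorts_dominated` — if every positive-weight neighbour of `o` is a RELAY (a "port") and `q` is at
  least as often light in `G − o` as every port (`s(p) ≤ s(q)`), then `μ(L) ≤ μ(R_q ∩ {1 ≤ N})`: the conclusion of
  `stub_attachedChampionDeleted` (XZ-H) for relay-neighboured observers, with the champion hypothesis weakened to domination of the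
  ports only (the lead's (V1) "domination of the hull ports in `s^{G−o}` suffices", hull `= {o}`, any number of ports, T-form).
  On `E_Γ` some port is joined to `o`, so `E_Γ ⊆ {1 ≤ N}` pointwise.

So for relay-neighboured observers the T-form deficiency of ANY witness `q` is at most `E_σ[min_{p ∈ σ} (s(p) − s(q))⁺]`
(selector = the port of the star least light in `G − o`), sharper than "`max_ports (s(p) − s(q))⁺`".
-/

noncomputable section

namespace Summit.CriticalPhenomena.PercolationContinuityZ3.Theorems

open MeasureTheory Set Literature.Probability.LatticeModels Literature.Probability.Percolation
open scoped Classical BigOperators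

variable {n : ℕ}

open CutObserver KNPreFKG in
/-- **XZ (T-form) up to the star deficiency, every observer, every witness.**  `o ∉ A`, `q ≠ o`, `Γ` the positive-weight
neighbours of `o`, `f` a member selector.  Then
`μ{1 ≤ N ≤ j} ≤ μ({|π(q)| ≤ j} ∩ {∃ y ∈ Γ, o–y open}) + Σ_{∅ ≠ B ⊆ Γ} μ(σ_B)·max (s(f B) − s(q)) 0`.
[cite: VandenbergHaggstromKahn2005, Thm. 1.5 (p. 7); KozmaNitzan2024, Lemma 5 (pp. 13–14) — star decomposition] -/
theorem xz_add_starDeficiency (w : Sym2 (Fin n) → unitInterval) (A : Finset (Fin n)) (o q : Fin n) (j : ℕ)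
    (hoA : o ∉ A) (hqo : q ≠ o) (f : Finset (Fin n) → Fin n)
    (hf : ∀ B : Finset (Fin n), B.Nonempty → B ⊆ (Finset.univ.filter fun v => v ≠ o ∧ w s(o, v) ≠ 0) → f B ∈ B) :
    (prodBernoulli w).real {ω : BondConfig (Fin n) |
        1 ≤ (A.filter fun x => ω ∈ openConn o x).card ∧ (A.filter fun x => ω ∈ openConn o x).card ≤ j} ≤
    (prodBernoulli w).real ({ω : BondConfig (Fin n) | (A.filter fun x => ω ∈ openConn q x).card ≤ j} ∩
        {ω | ∃ y ∈ (Finset.univ.filter fun v => v ≠ o ∧ w s(o, v) ≠ 0), s(o, y) ∈ ω}) +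
      ∑ B ∈ (Finset.univ.filter fun v => v ≠ o ∧ w s(o, v) ≠ 0).powerset.erase ∅,
        (prodBernoulli w).real (starEvent o (↑B : Set (Fin n))) *
          max ((prodBernoulli w).real {ω : BondConfig (Fin n) |
          (A.filter fun z => (openGraph (ω ∩ {e | o ∉ e})).Reachable (f B) z).card ≤ j} -
            (prodBernoulli w).real {ω : BondConfig (Fin n) |
          (A.filter fun z => (openGraph (ω ∩ {e | o ∉ e})).Reachable q z).card ≤ j}) 0 := by
  haveI : IsProbabilityMeasure (prodBernoulli w) := inferInstance
  set μ := prodBernoulli w with hμ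
  set L := {ω : BondConfig (Fin n) |
    1 ≤ (A.filter fun x => ω ∈ openConn o x).card ∧ (A.filter fun x => ω ∈ openConn o x).card ≤ j} with hL
  set Rq := {ω : BondConfig (Fin n) | (A.filter fun x => ω ∈ openConn q x).card ≤ j} with hRq
  set sW : Fin n → ℝ := fun y => μ.real {ω : BondConfig (Fin n) |
    (A.filter fun z => (openGraph (ω ∩ {e | o ∉ e})).Reachable y z).card ≤ j} with hsW
  set Γ : Finset (Fin n) := Finset.univ.filter fun v => v ≠ o ∧ w s(o, v) ≠ 0 with hΓ
  set EΓ := {ω : BondConfig (Fin n) | ∃ y ∈ Γ, s(o, y) ∈ ω} with hEΓ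
  change μ.real L ≤ μ.real (Rq ∩ EΓ) +
    ∑ B ∈ Γ.powerset.erase ∅, μ.real (starEvent o (↑B : Set (Fin n))) * max (sW (f B) - sW q) 0
  have hΓo : o ∉ Γ := by
    rw [hΓ, Finset.mem_filter]; exact fun h => h.2.1 rfl
  have hiso : ∀ v, v ≠ o → v ∉ Γ → w s(o, v) = 0 := by
    intro v hvo hvΓ
    by_contra hne
    exact hvΓ (Finset.mem_filter.2 ⟨Finset.mem_univ _, hvo, hne⟩)
  have h0mem : (∅ : Finset (Fin n)) ∈ Γ.powerset := Finset.empty_mem_powerset Γ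
  -- star decompositions of `L` and of `Rq ∩ EΓ`
  have hdecL := real_eq_sum_inter_starEvent w Γ o hΓo hiso L
  have hdecE := real_eq_sum_inter_starEvent w Γ o hΓo hiso (Rq ∩ EΓ)
  rw [← Finset.add_sum_erase _ _ h0mem] at hdecL hdecE
  -- the empty star carries neither `L` nor `EΓ`
  have hL0 : μ.real (L ∩ starEvent o ↑(∅ : Finset (Fin n))) = 0 := by
    have h0 : L ∩ starEvent o ↑(∅ : Finset (Fin n)) = (∅ : Set (BondConfig (Fin n))) := by
      ext ω
      simp only [mem_inter_iff, mem_empty_iff_false, iff_false, not_and]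
      intro hLω hσ
      rw [Finset.coe_empty] at hσ
      obtain ⟨x, hx⟩ := Finset.card_pos.1 (lt_of_lt_of_le Nat.zero_lt_one hLω.1)
      rw [Finset.mem_filter] at hx
      exact not_reachable_of_mem_starEvent_empty hσ (fun h => hoA (h ▸ hx.1)) hx.2
    rw [h0, measureReal_empty]
  have hE0 : μ.real (Rq ∩ EΓ ∩ starEvent o ↑(∅ : Finset (Fin n))) = 0 := by
    have h0 : Rq ∩ EΓ ∩ starEvent o ↑(∅ : Finset (Fin n)) = (∅ : Set (BondConfig (Fin n))) := by
      ext ω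
      constructor
      · rintro ⟨⟨_, y, hyΓ, hoy⟩, hσ⟩
        have hyo : y ≠ o := (Finset.mem_filter.1 hyΓ).2.1
        rw [Finset.coe_empty] at hσ
        exact ((mem_starEvent_iff o (∅ : Set (Fin n)) ω).1 hσ y hyo).1 hoy
      · intro h; exact h.elim
    rw [h0, measureReal_empty]
  -- on a nonempty star inside `Γ`, `EΓ` holds
  have hEB : ∀ B ∈ Γ.powerset.erase ∅,
      Rq ∩ EΓ ∩ starEvent o (↑B : Set (Fin n)) = Rq ∩ starEvent o (↑B : Set (Fin n)) := by
    intro B hB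
    have hBne : B.Nonempty := Finset.nonempty_iff_ne_empty.2 (Finset.ne_of_mem_erase hB)
    have hBΓ : B ⊆ Γ := Finset.mem_powerset.1 (Finset.mem_of_mem_erase hB)
    ext ω
    simp only [mem_inter_iff, hEΓ, mem_setOf_eq]
    constructor
    · rintro ⟨⟨h1, _⟩, h3⟩; exact ⟨h1, h3⟩
    · rintro ⟨h1, h3⟩
      obtain ⟨y, hy⟩ := hBne
      have hyo : y ≠ o := (Finset.mem_filter.1 (hBΓ hy)).2.1
      exact ⟨⟨h1, y, hBΓ hy, ((mem_starEvent_iff o (↑B : Set (Fin n)) ω).1 h3 y hyo).2 (Finset.mem_coe.2 hy)⟩, h3⟩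
  -- the nonempty stars: transfer with the QLM slack (as in `cil_add_starDeficiency`)
  have hstar : ∀ B ∈ Γ.powerset.erase ∅,
      μ.real (L ∩ starEvent o ↑B) ≤ μ.real (Rq ∩ starEvent o ↑B) +
        μ.real (starEvent o (↑B : Set (Fin n))) * max (sW (f B) - sW q) 0 := by
    intro B hB
    have hBne : B.Nonempty := Finset.nonempty_iff_ne_empty.2 (Finset.ne_of_mem_erase hB)
    have hBΓ : B ⊆ Γ := Finset.mem_powerset.1 (Finset.mem_of_mem_erase hB)
    have hBo : ∀ y ∈ B, y ≠ o := fun y hy => (Finset.mem_filter.1 (hBΓ hy)).2.1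
    have hfB : f B ∈ B := hf B hBne hBΓ
    refine star_transfer_add w A o q j hoA hqo B hBo (max (sW (f B) - sW q) 0) ?_
    have key := observerSet_le_add_posPart (fun e => if e ∈ {e : Sym2 (Fin n) | o ∉ e} then w e else 0)
      A B (f B) q hfB j
    have e1 : ∀ x : Fin n, {ω : BondConfig (Fin n) |
          (A.filter fun z => (openGraph (ω ∩ {e | o ∉ e})).Reachable x z).card ≤ j} =
        {ω : BondConfig (Fin n) | ω ∩ {e | o ∉ e} ∈
          {ξ : BondConfig (Fin n) | (A.filter fun z => ξ ∈ openConn x z).card ≤ j}} := by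
      intro x; ext ω; simp only [mem_setOf_eq, filter_avoid_eq]
    have e2 : {ω : BondConfig (Fin n) |
          (∀ y ∈ B, ¬ (openGraph (ω ∩ {e | o ∉ e})).Reachable q y) ∧
            1 ≤ (A.filter fun z => ∃ y ∈ B, (openGraph (ω ∩ {e | o ∉ e})).Reachable y z).card ∧
            (A.filter fun z => ∃ y ∈ B, (openGraph (ω ∩ {e | o ∉ e})).Reachable y z).card ≤ j} =
        {ω : BondConfig (Fin n) | ω ∩ {e | o ∉ e} ∈
          {ξ : BondConfig (Fin n) | (∀ x ∈ B, ξ ∉ openConn q x) ∧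
            1 ≤ (A.filter fun z => ∃ x ∈ B, ξ ∈ openConn x z).card ∧
            (A.filter fun z => ∃ x ∈ B, ξ ∈ openConn x z).card ≤ j}} := by
      ext ω; simp only [mem_setOf_eq, filter_avoid_exists_eq]; exact Iff.rfl
    have e3 : {ω : BondConfig (Fin n) |
          (∀ y ∈ B, ¬ (openGraph (ω ∩ {e | o ∉ e})).Reachable q y) ∧
            (A.filter fun z => (openGraph (ω ∩ {e | o ∉ e})).Reachable q z).card ≤ j} =
        {ω : BondConfig (Fin n) | ω ∩ {e | o ∉ e} ∈
          {ξ : BondConfig (Fin n) | (∀ x ∈ B, ξ ∉ openConn q x) ∧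
            (A.filter fun z => ξ ∈ openConn q z).card ≤ j}} := by
      ext ω; simp only [mem_setOf_eq, filter_avoid_eq]; exact Iff.rfl
    have hsf : sW (f B) = (prodBernoulli fun e => if e ∈ {e : Sym2 (Fin n) | o ∉ e} then w e else 0).real
        {ξ : BondConfig (Fin n) | (A.filter fun z => ξ ∈ openConn (f B) z).card ≤ j} := by
      simp only [hsW]; rw [e1 (f B), measureReal_preimage_avoid]
    have hsq : sW q = (prodBernoulli fun e => if e ∈ {e : Sym2 (Fin n) | o ∉ e} then w e else 0).real
        {ξ : BondConfig (Fin n) | (A.filter fun z => ξ ∈ openConn q z).card ≤ j} := by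
      simp only [hsW]; rw [e1 q, measureReal_preimage_avoid]
    rw [e2, e3, measureReal_preimage_avoid, measureReal_preimage_avoid, hsf, hsq]
    convert key using 3
  -- assemble
  have hsum := Finset.sum_le_sum hstar
  rw [Finset.sum_add_distrib] at hsum
  have hE : ∑ B ∈ Γ.powerset.erase ∅, μ.real (Rq ∩ starEvent o (↑B : Set (Fin n))) =
      ∑ B ∈ Γ.powerset.erase ∅, μ.real (Rq ∩ EΓ ∩ starEvent o (↑B : Set (Fin n))) :=
    Finset.sum_congr rfl fun B hB => by rw [hEB B hB]
  rw [hdecL, hL0, zero_add]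
  rw [hdecE, hE0, zero_add, ← hE]
  linarith [hsum]

open CutObserver KNPreFKG in
/-- **XZ-H for relay-neighboured observers from PORT DOMINATION.**  Let `o ∉ A`, every positive-weight neighbour of `o` be a
relay ("port"), and let `q ≠ o` be at least as often light in `G − o` as every port (`s(p) ≤ s(q)`).  Then
`μ{1 ≤ N ≤ j} ≤ μ({|π(q)| ≤ j} ∩ {1 ≤ N})` — the conclusion of the registered stub `stub_attachedChampionDeleted` for this
observer (there `q` is a champion of `G − o`, which dominates the ports in particular).  [cite: VandenbergHaggstromKahn2005, Thm. 1.5 (p. 7)] -/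
theorem attachedChampion_of_relayPorts_dominated (w : Sym2 (Fin n) → unitInterval) (A : Finset (Fin n)) (o q : Fin n)
    (j : ℕ) (hoA : o ∉ A) (hqo : q ≠ o)
    (hports : ∀ y : Fin n, y ≠ o → w s(o, y) ≠ 0 → y ∈ A)
    (hdom : ∀ y : Fin n, y ≠ o → w s(o, y) ≠ 0 →
      (prodBernoulli w).real {ω : BondConfig (Fin n) |
          (A.filter fun z => (openGraph (ω ∩ {e | o ∉ e})).Reachable y z).card ≤ j} ≤
        (prodBernoulli w).real {ω : BondConfig (Fin n) |
          (A.filter fun z => (openGraph (ω ∩ {e | o ∉ e})).Reachable q z).card ≤ j}) :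
    (prodBernoulli w).real {ω : BondConfig (Fin n) |
        1 ≤ (A.filter fun x => ω ∈ openConn o x).card ∧ (A.filter fun x => ω ∈ openConn o x).card ≤ j} ≤
      (prodBernoulli w).real {ω : BondConfig (Fin n) |
        (A.filter fun x => ω ∈ openConn q x).card ≤ j ∧ 1 ≤ (A.filter fun x => ω ∈ openConn o x).card} := by
  haveI : IsProbabilityMeasure (prodBernoulli w) := inferInstance
  set μ := prodBernoulli w with hμ
  set sW : Fin n → ℝ := fun y => μ.real {ω : BondConfig (Fin n) |
    (A.filter fun z => (openGraph (ω ∩ {e | o ∉ e})).Reachable y z).card ≤ j} with hsW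
  set Γ : Finset (Fin n) := Finset.univ.filter fun v => v ≠ o ∧ w s(o, v) ≠ 0 with hΓ
  change ∀ y : Fin n, y ≠ o → w s(o, y) ≠ 0 → sW y ≤ sW q at hdom
  -- selector: any member
  set f : Finset (Fin n) → Fin n := fun B => if h : B.Nonempty then h.choose else o with hf
  have hfmem : ∀ B : Finset (Fin n), B.Nonempty → f B ∈ B := by
    intro B hB; simp only [hf]; rw [dif_pos hB]; exact hB.choose_spec
  have hmain := xz_add_starDeficiency w A o q j hoA hqo f (fun B hB _ => hfmem B hB)
  -- all slacks vanish
  have hzero : ∑ B ∈ Γ.powerset.erase ∅, μ.real (starEvent o (↑B : Set (Fin n))) * max (sW (f B) - sW q) 0 = 0 := by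
    refine Finset.sum_eq_zero fun B hB => ?_
    have hBne : B.Nonempty := Finset.nonempty_iff_ne_empty.2 (Finset.ne_of_mem_erase hB)
    have hBΓ : B ⊆ Γ := Finset.mem_powerset.1 (Finset.mem_of_mem_erase hB)
    have hfΓ := Finset.mem_filter.1 (hBΓ (hfmem B hBne))
    have h0 : max (sW (f B) - sW q) 0 = 0 := max_eq_right (by linarith [hdom (f B) hfΓ.2.1 hfΓ.2.2])
    rw [h0, mul_zero]
  change μ.real _ ≤ μ.real (_ ∩ _) + ∑ B ∈ Γ.powerset.erase ∅,
    μ.real (starEvent o (↑B : Set (Fin n))) * max (sW (f B) - sW q) 0 at hmain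
  rw [hzero, add_zero] at hmain
  refine hmain.trans (measureReal_mono ?_)
  rintro ω ⟨hR, y, hyΓ, hoy⟩
  have hyf := Finset.mem_filter.1 hyΓ
  have hyA : y ∈ A := hports y hyf.2.1 hyf.2.2
  refine ⟨hR, Finset.card_pos.2 ⟨y, Finset.mem_filter.2 ⟨hyA, ?_⟩⟩⟩
  have hadj : (openGraph ω).Adj o y := by
    rw [openGraph, SimpleGraph.fromEdgeSet_adj]; exact ⟨hoy, hyf.2.1.symm⟩
  exact hadj.reachable

end Summit.CriticalPhenomena.PercolationContinuityZ3.Theorems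

end
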